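import Summits.NavierStokesRegularity.FluidComputer.PalasekTowerFaceScalingLaws

/-!
# The τ₁ faces of the register as universal Navier–Stokes constants, VII: the level-1 letter in the two variables
# `Re₀ = N₀^{β−2}` and `σ = N₁/N₀ = N₀^{b−1}` — LACUNARITY LAWS and the CORE-SURVIVAL NUMBER (crux `EpisodeBase`,
# stmt-NavierStokesRegularity-19179)

Cell `ns-blowup`, seat `ns-palasek-19179-p2` (g5; holder of record of the crux `EpisodeBase` = `EpisodeBaseG` of the route
`PalasekTowerBreakdown`, line `slot`). Sequel of `PalasekTowerFaceScalingLaws.lean` (VI, p504675: the speed / gradient / window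
laws `Y_{k+1}/Y_k = N_k^{(b−1)(β−1)}`, `A_{k+1}/Y_k² = N_k^{bβ−2(β−1)}`, `w_k Y_k² = 4b²β log N_k · N_k^{β−2}` for an arbitrary rates record).
The holder's RE-TUNING BRIEF v1.1 (19179 evidence #53) reads the whole level-`1` letter of `EpisodeBaseG` in the TWO numbers

* `Re₀ := N₀^{β−2}` — the level-`0` core radius `Y₀/N₀` in anchored lengths `ν/Y₀`, equal to its circulation floor and to its core
  Reynolds number (K128 (α)), and
* `σ := N₁/N₀ = N₀^{b−1}` — the LACUNARITY of the first step,

namely (speed unit `Y₀`, `ν = 1`): speed face `F = σ^{β−1}`, gradient face `G = σ^β/Re₀`, window `s₀ = 4b²β · log N₀ · Re₀`, child core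
radius `r_c = Y₀/N₁ = Re₀/σ`, child circulation `Γ_c = N₁^{β−2} = σ^{β−2} Re₀`, and the CORE-SURVIVAL NUMBER
`κ := r_c²/s₀ = Re₀/(4b²β σ² log N₀) = N₀^{β−2b}/(4b²β log N₀)` — the reciprocal of ecbridge-5 g3's «window in CHILD diffusion units»
(`Schedule.Rigid.window_mul_N_succ_sq`, `PalasekTowerRegisterGlobalCoreWindow.lean`; DC1 `2b < β` ⇔ `κ → ∞` along `N₀ → ∞` at fixed
`(b, β)`). This file PROVES those identities for an arbitrary `R : TowerRates` (§9), the rigidity `σ < F` of the speed step against the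
scale step (`σ^{β−1} > σ` because `β − 1 > 1`: every admissible register asks MORE sup-speed amplification per level than its scale
separation, §9), and the wide numbers by name (§10): `r_c = 2^{8/5} ∈ (3.031, 3.032)`, `κ_wide = 256^{1/10}/((2783/250) · log 256)
∈ (0.0282, 0.0283)` (the registered child core diffuses in `1/35` of the window). LABEL: E–C typing (KERNEL, exact rate algebra +
certified arithmetic). WHAT THIS IS NOT: not Navier–Stokes evidence — identities between the REGISTER's constants; nothing about any
flow, about `EpisodeBase` or blow-up; no re-tuning is proposed here (the planner's call, D-0014; the brief's HEUR readings stay out of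
the kernel).

References: S. Palasek, arXiv:2605.13827 §1.2, §3.1 (3.2), §3.3 [cite: Palasek2026ElementaryModel, §3.3]; K128 (ns-blowup STATUS
2026-08-27T05:22Z); RE-TUNING BRIEF v1.1 (19179 evidence #53).
-/

noncomputable section

namespace Summit.NavierStokesRegularity.FluidComputer.PalasekTowerClayBridge

open Set MeasureTheory Filter Topology Function
open scoped ENNReal ContDiff NNReal
open Literature.Analysis.FluidPDE

/-! ## §9 The level-1 letter in the variables `Re₀ = N₀^{β−2}`, `σ = N₀^{b−1}` (arbitrary rates) -/

namespace TowerRates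

variable (R : TowerRates)

/-- `N 0 = N₀`. [cite: Palasek2026ElementaryModel, §1.2] -/
theorem N_zero_eq_N₀ : R.N 0 = R.N₀ := by
  simp only [TowerRates.N, pow_zero, Real.rpow_one]

/-- The base scale is positive. [folklore] -/
theorem N₀_pos : 0 < R.N₀ := lt_trans one_pos R.one_lt_N₀

/-- `N₁ = N₀^b`. [cite: Palasek2026ElementaryModel, §1.2] -/
theorem N_one_eq : R.N 1 = R.N₀ ^ R.b := by
  simp only [TowerRates.N, pow_one]

/-- **The first lacunarity step**: `N₁ = σ · N₀` with `σ = N₀^{b−1}`. [cite: Palasek2026ElementaryModel, §1.2] -/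
theorem N_one_eq_sigma_mul : R.N 1 = R.N₀ ^ (R.b - 1) * R.N₀ := by
  rw [R.N_one_eq]
  conv_rhs => rw [← Real.rpow_one R.N₀, ← Real.rpow_mul R.N₀_pos.le, one_mul, ← Real.rpow_add R.N₀_pos]
  congr 1
  ring

/-- The lacunarity `σ = N₀^{b−1}` exceeds one. [folklore] -/
theorem one_lt_sigma : 1 < R.N₀ ^ (R.b - 1) :=
  Real.one_lt_rpow R.one_lt_N₀ (by linarith [R.one_lt_b])

/-- The lacunarity `σ` is positive. [folklore] -/
theorem sigma_pos : 0 < R.N₀ ^ (R.b - 1) := Real.rpow_pos_of_pos R.N₀_pos _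

/-- **Speed face in lacunarity form**: `F = Y₁/Y₀ = σ^{β−1}`. [cite: Palasek2026ElementaryModel, §1.2] -/
theorem Y_one_div_Y_zero_eq_sigma_rpow : R.Y 1 / R.Y 0 = (R.N₀ ^ (R.b - 1)) ^ (R.β - 1) := by
  have h : R.Y 1 / R.Y 0 = R.N 0 ^ ((R.b - 1) * (R.β - 1)) := R.Y_succ_div_Y 0
  rw [h, R.N_zero_eq_N₀, ← Real.rpow_mul R.N₀_pos.le]

/-- **The speed step beats the scale step**: `σ < σ^{β−1} = F` — with `β − 1 > 1` (DC1) every admissible register asks a sup-speed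
amplification per level LARGER than its scale separation. [folklore] -/
theorem sigma_lt_Y_one_div_Y_zero : R.N₀ ^ (R.b - 1) < R.Y 1 / R.Y 0 := by
  rw [R.Y_one_div_Y_zero_eq_sigma_rpow]
  conv_lhs => rw [← Real.rpow_one (R.N₀ ^ (R.b - 1))]
  exact Real.rpow_lt_rpow_of_exponent_lt R.one_lt_sigma (by linarith [R.two_lt_β])

/-- **Gradient face in lacunarity form**: `G = A₁/Y₀² = σ^β / Re₀`. [cite: Palasek2026ElementaryModel, §3.1] -/
theorem A_one_div_Y_zero_sq_eq : R.A 1 / R.Y 0 ^ 2 = (R.N₀ ^ (R.b - 1)) ^ R.β / R.N₀ ^ (R.β - 2) := by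
  have h : R.A 1 / R.Y 0 ^ 2 = R.N 0 ^ (R.b * R.β - 2 * (R.β - 1)) := R.A_succ_div_Y_sq 0
  rw [h, R.N_zero_eq_N₀, ← Real.rpow_mul R.N₀_pos.le, ← Real.rpow_sub R.N₀_pos]
  congr 1
  ring

/-- **Window in lacunarity form**: `s₀ = w₀ Y₀² = 4b²β · log N₀ · Re₀`. [cite: Palasek2026ElementaryModel, §3.3] -/
theorem window_zero_mul_Y_zero_sq : R.window 0 * R.Y 0 ^ 2 = 4 * R.b ^ 2 * R.β * Real.log R.N₀ * R.N₀ ^ (R.β - 2) := by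
  rw [R.window_mul_Y_sq 0, R.N_zero_eq_N₀]

/-- **Child core radius in anchored lengths**: `r_c = Y₀/N₁ = Re₀/σ` (the level-`1` core ball `1/N₁` in the unit `ν/Y₀`).
[cite: Palasek2026ElementaryModel, §3.1] -/
theorem Y_zero_div_N_one_eq : R.Y 0 / R.N 1 = R.N₀ ^ (R.β - 2) / R.N₀ ^ (R.b - 1) := by
  have hσ : R.N₀ ^ (R.b - 1) ≠ 0 := R.sigma_pos.ne'
  have hN1 : R.N 1 ≠ 0 := (R.N_pos 1).ne'
  rw [div_eq_div_iff hN1 hσ]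
  simp only [TowerRates.Y]
  rw [R.N_zero_eq_N₀, R.N_one_eq, ← Real.rpow_add R.N₀_pos, ← Real.rpow_add R.N₀_pos]
  congr 1
  ring

/-- **Child circulation in lacunarity form**: `Γ_c = N₁^{β−2} = σ^{β−2} · Re₀`. [cite: Palasek2026ElementaryModel, §3.1] -/
theorem N_one_rpow_β_sub_two_eq : R.N 1 ^ (R.β - 2) = (R.N₀ ^ (R.b - 1)) ^ (R.β - 2) * R.N₀ ^ (R.β - 2) := by
  rw [R.N_one_eq_sigma_mul, Real.mul_rpow R.sigma_pos.le R.N₀_pos.le]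

/-- **The window at the child scale, schedule-free form**: `w₀ · N₁² = 4b²β · log N₀ · N₀^{2b−β}` (the rigid-schedule version is
`Schedule.Rigid.window_mul_N_succ_sq`). [cite: Palasek2026ElementaryModel, §3.1] -/
theorem window_zero_mul_N_one_sq : R.window 0 * R.N 1 ^ 2 = 4 * R.b ^ 2 * R.β * Real.log R.N₀ * R.N₀ ^ (2 * R.b - R.β) := by
  have hA : R.A 0 ≠ 0 := (R.A_pos 0).ne'
  have hw : R.window 0 = 4 * R.b * R.β * Real.log (R.N (0 + 1)) / R.A 0 := rfl
  have hN12 : R.N 1 ^ 2 = R.N₀ ^ (2 * R.b) := by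
    rw [R.N_one_eq, sq, ← Real.rpow_add R.N₀_pos]; congr 1; ring
  have hA0 : R.A 0 = R.N₀ ^ R.β := by simp only [TowerRates.A]; rw [R.N_zero_eq_N₀]
  have hsplit : R.N₀ ^ (2 * R.b) = R.N₀ ^ (2 * R.b - R.β) * R.N₀ ^ R.β := by
    rw [← Real.rpow_add R.N₀_pos]; congr 1; ring
  rw [hw, show 0 + 1 = 1 from rfl, R.log_N_succ 0, R.N_zero_eq_N₀, hN12, hA0, hsplit]
  have hβ0 : R.N₀ ^ R.β ≠ 0 := (Real.rpow_pos_of_pos R.N₀_pos _).ne'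
  field_simp

/-- **THE CORE-SURVIVAL NUMBER**: `κ := r_c² / s₀ = (Y₀/N₁)² / (w₀ Y₀²) = N₀^{β−2b} / (4b²β log N₀)` — the child core's diffusion time
over the window. [folklore] -/
theorem coreSurvival_eq :
    (R.Y 0 / R.N 1) ^ 2 / (R.window 0 * R.Y 0 ^ 2) = R.N₀ ^ (R.β - 2 * R.b) / (4 * R.b ^ 2 * R.β * Real.log R.N₀) := by
  have hlog : Real.log R.N₀ ≠ 0 := (Real.log_pos R.one_lt_N₀).ne'
  have hb : R.b ≠ 0 := by have := R.one_lt_b; positivity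
  have hβ : R.β ≠ 0 := by have := R.two_lt_β; positivity
  have hRe : R.N₀ ^ (R.β - 2) ≠ 0 := (Real.rpow_pos_of_pos R.N₀_pos _).ne'
  have hσ : R.N₀ ^ (R.b - 1) ≠ 0 := R.sigma_pos.ne'
  have hsq : (R.N₀ ^ (R.β - 2) / R.N₀ ^ (R.b - 1)) ^ 2 = R.N₀ ^ (R.β - 2 * R.b) * R.N₀ ^ (R.β - 2) := by
    rw [div_pow, sq, sq, ← Real.rpow_add R.N₀_pos, ← Real.rpow_add R.N₀_pos, div_eq_iff
      (Real.rpow_pos_of_pos R.N₀_pos _).ne', ← Real.rpow_add R.N₀_pos, ← Real.rpow_add R.N₀_pos]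
    congr 1; ring
  rw [R.Y_zero_div_N_one_eq, R.window_zero_mul_Y_zero_sq, hsq]
  field_simp

/-- `κ` in lacunarity form: `κ = Re₀ / (4b²β σ² log N₀)`. [folklore] -/
theorem coreSurvival_eq_sigma :
    (R.Y 0 / R.N 1) ^ 2 / (R.window 0 * R.Y 0 ^ 2) =
      R.N₀ ^ (R.β - 2) / (4 * R.b ^ 2 * R.β * (R.N₀ ^ (R.b - 1)) ^ 2 * Real.log R.N₀) := by
  rw [R.coreSurvival_eq]
  have hσ2 : (R.N₀ ^ (R.b - 1)) ^ 2 = R.N₀ ^ (2 * R.b - 2) := by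
    rw [sq, ← Real.rpow_add R.N₀_pos]; congr 1; ring
  have hsplit : R.N₀ ^ (R.β - 2) = R.N₀ ^ (R.β - 2 * R.b) * R.N₀ ^ (2 * R.b - 2) := by
    rw [← Real.rpow_add R.N₀_pos]; congr 1; ring
  have hd : R.N₀ ^ (2 * R.b - 2) ≠ 0 := (Real.rpow_pos_of_pos R.N₀_pos _).ne'
  rw [hσ2, hsplit, show 4 * R.b ^ 2 * R.β * R.N₀ ^ (2 * R.b - 2) * Real.log R.N₀ =
    4 * R.b ^ 2 * R.β * Real.log R.N₀ * R.N₀ ^ (2 * R.b - 2) by ring, mul_div_mul_right _ _ hd]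

/-- **`κ` is the reciprocal of the window at the child scale**: `κ · (w₀ N₁²) = 1`. [folklore] -/
theorem coreSurvival_mul_window_zero_mul_N_one_sq :
    (R.Y 0 / R.N 1) ^ 2 / (R.window 0 * R.Y 0 ^ 2) * (R.window 0 * R.N 1 ^ 2) = 1 := by
  rw [R.coreSurvival_eq, R.window_zero_mul_N_one_sq]
  have hlog : Real.log R.N₀ ≠ 0 := (Real.log_pos R.one_lt_N₀).ne'
  have hb : R.b ≠ 0 := by have := R.one_lt_b; positivity
  have hβ : R.β ≠ 0 := by have := R.two_lt_β; positivity
  have hD : 4 * R.b ^ 2 * R.β * Real.log R.N₀ ≠ 0 := by positivity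
  have hprod : R.N₀ ^ (R.β - 2 * R.b) * R.N₀ ^ (2 * R.b - R.β) = 1 := by
    rw [← Real.rpow_add R.N₀_pos, show R.β - 2 * R.b + (2 * R.b - R.β) = 0 by ring, Real.rpow_zero]
  rw [div_mul_eq_mul_div, show R.N₀ ^ (R.β - 2 * R.b) * (4 * R.b ^ 2 * R.β * Real.log R.N₀ * R.N₀ ^ (2 * R.b - R.β)) =
    4 * R.b ^ 2 * R.β * Real.log R.N₀ * (R.N₀ ^ (R.β - 2 * R.b) * R.N₀ ^ (2 * R.b - R.β)) by ring, hprod, mul_one,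
    div_self hD]

/-- `κ` is positive. [folklore] -/
theorem coreSurvival_pos : 0 < (R.Y 0 / R.N 1) ^ 2 / (R.window 0 * R.Y 0 ^ 2) := by
  rw [R.coreSurvival_eq]
  have := R.one_lt_b
  have := R.two_lt_β
  have := Real.log_pos R.one_lt_N₀
  have := Real.rpow_pos_of_pos R.N₀_pos (R.β - 2 * R.b)
  positivity

/-- **DC1 as growth of the survival numerator**: `N₀^{β−2b} > 1` (so `κ · 4b²β log N₀ > 1`), the exponent `β − 2b` being
positive by DC1. [cite: Palasek2026ElementaryModel, §3.1 (3.2)] -/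
theorem one_lt_N₀_rpow_β_sub_two_b : 1 < R.N₀ ^ (R.β - 2 * R.b) :=
  Real.one_lt_rpow R.one_lt_N₀ (by linarith [R.two_b_lt_β])

end TowerRates

/-! ## §10 The wide rates: child core radius and the core-survival number, certified -/

namespace UniversalFace

open TowerRates

/-- **Registered child core radius in anchored lengths**: `Y₀/N₁ = 2^{52/5 − 44/5} = 2^{8/5}` on the wide rates. [folklore] -/
theorem wide_Y_zero_div_N_one_eq : wide.Y 0 / wide.N 1 = (2 : ℝ) ^ ((8 : ℝ) / 5) := by
  rw [wide.Y_zero_div_N_one_eq]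
  have hN : wide.N₀ = (2 : ℝ) ^ (8 : ℝ) := by simp only [wide]; norm_num
  have hβ : wide.β - 2 = 3 / 10 := by simp only [wide]; norm_num
  have hb : wide.b - 1 = 1 / 10 := by simp only [wide]; norm_num
  rw [hN, hβ, hb, ← Real.rpow_mul (by norm_num), ← Real.rpow_mul (by norm_num),
    ← Real.rpow_sub (by norm_num : (0 : ℝ) < 2)]
  norm_num

/-- `Y₀/N₁ ∈ (3.031, 3.032)` (`3.031⁵ < 256 < 3.032⁵`): the level-`1` core ball has radius `≈ 3.03` viscous lengths of the
level-`0` anchor. [folklore] -/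
theorem wide_Y_zero_div_N_one_bounds : 3.031 < wide.Y 0 / wide.N 1 ∧ wide.Y 0 / wide.N 1 < 3.032 := by
  rw [wide_Y_zero_div_N_one_eq]
  exact ⟨lt_two_rpow_of_pow_lt (a := 8) (m := 1) (r := 5) (by norm_num) (by norm_num),
    two_rpow_lt_of_pow_lt (by norm_num) (a := 8) (m := 1) (r := 5) (by norm_num) (by norm_num)⟩

/-- **The registered core-survival number, closed form**: `κ_wide = (Y₀/N₁)²/windowAnch = 256^{1/10} / ((2783/250) · log 256)`
(`β − 2b = 1/10`, `4b²β = 2783/250`). [folklore] -/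
theorem wide_coreSurvival_eq :
    (wide.Y 0 / wide.N 1) ^ 2 / windowAnch = (256 : ℝ) ^ ((1 : ℝ) / 10) / ((2783 / 250) * Real.log 256) := by
  have h : windowAnch = wide.window 0 * wide.Y 0 ^ 2 := rfl
  rw [h, wide.coreSurvival_eq]
  simp only [wide]
  norm_num

/-- `256^{1/10} = 2^{4/5} ∈ (1.7411, 1.7412)`. [folklore] -/
theorem rpow_256_tenth_bounds : 1.7411 < (256 : ℝ) ^ ((1 : ℝ) / 10) ∧ (256 : ℝ) ^ ((1 : ℝ) / 10) < 1.7412 := by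
  have h : (256 : ℝ) ^ ((1 : ℝ) / 10) = (2 : ℝ) ^ ((4 : ℝ) / 5) := by
    rw [show (256 : ℝ) = (2 : ℝ) ^ (8 : ℝ) by norm_num, ← Real.rpow_mul (by norm_num)]
    norm_num
  rw [h]
  exact ⟨lt_two_rpow_of_pow_lt (a := 4) (m := 1) (r := 5) (by norm_num) (by norm_num),
    two_rpow_lt_of_pow_lt (by norm_num) (a := 4) (m := 1) (r := 5) (by norm_num) (by norm_num)⟩

/-- **`κ_wide ∈ (0.0282, 0.0283)`**: on the registered rates the level-`1` core ball diffuses in `≈ 1/35` of the growth window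
(`= 1.7411… / (11.132 · 5.5452)`; reciprocal of `Schedule.Rigid.window_mul_N_succ_sq_wide` at `k = 0`). [folklore] -/
theorem wide_coreSurvival_bounds :
    0.0282 < (wide.Y 0 / wide.N 1) ^ 2 / windowAnch ∧ (wide.Y 0 / wide.N 1) ^ 2 / windowAnch < 0.0283 := by
  rw [wide_coreSurvival_eq]
  obtain ⟨hlo, hhi⟩ := rpow_256_tenth_bounds
  have hl2lo := Real.log_two_gt_d9
  have hl2hi := Real.log_two_lt_d9
  have hlog : Real.log 256 = 8 * Real.log 2 := by
    rw [show (256 : ℝ) = 2 ^ 8 by norm_num, Real.log_pow]; norm_num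
  rw [hlog]
  have hden : 0 < (2783 : ℝ) / 250 * (8 * Real.log 2) := by positivity
  constructor
  · rw [lt_div_iff₀ hden]; nlinarith
  · rw [div_lt_iff₀ hden]; nlinarith

end UniversalFace

end Summit.NavierStokesRegularity.FluidComputer.PalasekTowerClayBridge

end
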